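import Summits.ABC.ABC.Theses.IneffectiveSubspace

/-!
# Calibration of the exponent dial of crux `IneffectiveSubspace.TowerFourSubLiouville` (stmt-ABC-1649)

Negative-side support (cdisprove seat refuter-cdisprove-stmt-ABC-1649-0, 2026-08-16).  The crux is
`∃ A < 2, TowerIneq(4, A)`, where `TowerIneq(4, A)` is the level-4 Vojta-tower
inequality `c < C(ε)·(∏ xᵢyᵢzᵢ)^{A+ε}` on positive coprime solutions of
`x₁x₂²x₃³x₄⁴ + y₁y₂²y₃³y₄⁴ = z₁z₂²z₃³z₄⁴`.  It cannot be refuted short of refuting `ABC`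
(`ABC ⟹ TowerIneq(4, 1)`, route item `AbcGivesTower`); this file records what IS decidable now
(all statements inlined, no auxiliary `def`s):

* load-bearing hypotheses: `towerFourSubLiouville_false_without_pos` (witness `x = (0,1,1,1)`,
  `Π = 0`), `towerFourSubLiouville_false_without_eq` (witness `z = (1,1,1,m)`);
* coprimality is not load-bearing for `∃ A < 2` but fixes the floor: without it the inequality fails
  for every `A < 4/3` (`towerIneq4NoCoprime_false_below_four_thirds`, `2^{4k} + 2^{4k} = 2·2^{4k}`);
* the dial cannot go below the conjectural optimum: `towerIneq4_false_below_one` (`∀ A < 1`, Pell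
  family `1 + 3v² = u²` embedded from level 2; packaged as `towerFour_false_with_threshold_one`), and at `A = 1` the `ε` cannot be dropped:
  `not_towerIneq4OneNoEps` (Matiyasevich's `Pell.ysq_dvd_yy`: `v = w²t`, `Π = 3uv/w`);
* constants: `quality_point_4375` (`1 + 2·3⁷ = 5⁴·7`, `Π = 630`, `630^{13/10} < 4375`): with `C = 1`
  the exponent must exceed `13/10` (`not_towerIneq4_constant_one_exponent_13_10`).

Tool: `key_growth` (`s < 1 ⟹ K·T^s ≤ T` for `T ≥ max 1 (K^{1/(1−s)})`).
-/

namespace Summit.ABC.ABC.Theorems.TowerFourSubLiouville.Negative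

open scoped BigOperators
open Summit.ABC.ABC.Theses.IneffectiveSubspace

/-- Growth lemma used by every witness family: for `s < 1`, `K * T ^ s ≤ T` for all large `T`. -/
theorem key_growth {K s : ℝ} (hK : 0 ≤ K) (hs : s < 1) :
    ∃ M : ℝ, 1 ≤ M ∧ ∀ T : ℝ, M ≤ T → K * T ^ s ≤ T := by
  refine ⟨max 1 (K ^ (1 - s)⁻¹), le_max_left _ _, fun T hT => ?_⟩
  have hT1 : 1 ≤ T := le_trans (le_max_left _ _) hT
  have hT0 : 0 < T := by linarith
  have hne : 1 - s ≠ 0 := (sub_pos.mpr hs).ne'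
  have h1 : K ≤ T ^ (1 - s) := by
    calc K = (K ^ (1 - s)⁻¹) ^ (1 - s) := (Real.rpow_inv_rpow hK hne).symm
      _ ≤ T ^ (1 - s) :=
        Real.rpow_le_rpow (Real.rpow_nonneg hK _) (le_trans (le_max_right _ _) hT) (sub_pos.mpr hs).le
  calc K * T ^ s ≤ T ^ (1 - s) * T ^ s := mul_le_mul_of_nonneg_right h1 (Real.rpow_nonneg hT0.le _)
    _ = T := by rw [← Real.rpow_add hT0, sub_add_cancel, Real.rpow_one]

/-- `(t ^ 4) ^ (s / 4) = t ^ s` for `t ≥ 0` (real exponent bookkeeping). -/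
theorem pow_four_rpow {t : ℝ} (ht : 0 ≤ t) (s : ℝ) : (t ^ 4) ^ (s / 4) = t ^ s := by
  rw [show t ^ 4 = t ^ (4:ℝ) by rw [← Real.rpow_natCast]; norm_num, ← Real.rpow_mul ht]
  congr 1; ring

/-- `(t ^ 3) ^ s = t ^ (3 * s)` for `t ≥ 0`. -/
theorem pow_three_rpow {t : ℝ} (ht : 0 ≤ t) (s : ℝ) : (t ^ 3) ^ s = t ^ (3 * s) := by
  rw [show t ^ 3 = t ^ (3:ℝ) by rw [← Real.rpow_natCast]; norm_num, ← Real.rpow_mul ht]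

/-! ## (a) Load-bearing hypotheses -/

/-- Positivity is load-bearing (through `Π = 0` only): witness `x = (0,1,1,1)`, `y = z = (1,1,1,1)`,
`0 + 1 = 1`, `gcd(0,1) = 1`, `Π = 0`, and `1 < C · 0 ^ (A+ε) = 0` fails (`ε := |A| + 1`). -/
theorem towerFourSubLiouville_false_without_pos :
    ¬ ∃ A : ℝ, A < 2 ∧ ∀ ε : ℝ, 0 < ε → ∃ C : ℝ, 0 < C ∧ ∀ x y z : Fin 4 → ℕ,
      (∏ i, x i ^ (i.val + 1)) + (∏ i, y i ^ (i.val + 1)) = ∏ i, z i ^ (i.val + 1) →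
      Nat.Coprime (∏ i, x i ^ (i.val + 1)) (∏ i, y i ^ (i.val + 1)) →
      ((∏ i, z i ^ (i.val + 1) : ℕ) : ℝ) < C * ((∏ i, x i * y i * z i : ℕ) : ℝ) ^ (A + ε) := by
  rintro ⟨A, -, h⟩
  have hε : (0 : ℝ) < |A| + 1 := by positivity
  obtain ⟨C, -, h⟩ := h (|A| + 1) hε
  have key := h ![0, 1, 1, 1] ![1, 1, 1, 1] ![1, 1, 1, 1] (by simp [Fin.prod_univ_four])
    (by simp [Fin.prod_univ_four])
  have hne : A + (|A| + 1) ≠ 0 := by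
    have := neg_abs_le A
    intro h0; linarith
  simp [Fin.prod_univ_four, Real.zero_rpow hne] at key
  norm_num at key

/-- The equation is load-bearing: witness `x = y = (1,1,1,1)`, `z = (1,1,1,m)`: `c = m⁴`, `Π = m`,
and `m⁴ < C m^{A+1}` fails for large `m` since `A + 1 < 3 < 4` (`ε := 1`). -/
theorem towerFourSubLiouville_false_without_eq :
    ¬ ∃ A : ℝ, A < 2 ∧ ∀ ε : ℝ, 0 < ε → ∃ C : ℝ, 0 < C ∧ ∀ x y z : Fin 4 → ℕ, (∀ i, 0 < x i ∧ 0 < y i ∧ 0 < z i) →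
      Nat.Coprime (∏ i, x i ^ (i.val + 1)) (∏ i, y i ^ (i.val + 1)) →
      ((∏ i, z i ^ (i.val + 1) : ℕ) : ℝ) < C * ((∏ i, x i * y i * z i : ℕ) : ℝ) ^ (A + ε) := by
  rintro ⟨A, hA, h⟩
  obtain ⟨C, hC, h⟩ := h 1 one_pos
  obtain ⟨M, hM1, hM⟩ := key_growth hC.le (by linarith : (A + 1) / 4 < 1)
  obtain ⟨m, hm⟩ := exists_nat_gt M
  have hm1 : (1 : ℝ) < m := lt_of_le_of_lt hM1 hm
  have hm0 : 0 < m := by exact_mod_cast (zero_lt_one.trans hm1)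
  have key := h ![1, 1, 1, 1] ![1, 1, 1, 1] ![1, 1, 1, m]
    (by intro i; fin_cases i <;> simp [hm0]) (by simp [Fin.prod_univ_four])
  simp [Fin.prod_univ_four] at key
  -- key : (m:ℝ) ^ 4 < C * (m:ℝ) ^ (A + 1)
  have hmm : (m : ℝ) ≤ (m : ℝ) ^ 4 := by exact_mod_cast Nat.le_self_pow (by norm_num : 4 ≠ 0) m
  have hb := hM ((m : ℝ) ^ 4) (by linarith [hm.le])
  rw [pow_four_rpow (by positivity)] at hb
  linarith

/-! ## (a') Coprimality: NOT load-bearing for `∃ A < 2` (heuristically; `ABC ⟹` the non-coprime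
version for every `A > 5/3`), but it moves the floor of the dial from `1` to `4/3`. -/

/-- Without coprimality the dial cannot go below `4/3`: `2^{4k} + 2^{4k} = 2·2^{4k}` with
`x = y = (1,1,1,2^k)`, `z = (2,1,1,2^k)` has `Π = 2·2^{3k}` and `c = 2·2^{4k} ≍ Π^{4/3}`. -/
theorem towerIneq4NoCoprime_false_below_four_thirds (A : ℝ) (hA : A < 4 / 3) :
    ¬ ∀ ε : ℝ, 0 < ε → ∃ C : ℝ, 0 < C ∧ ∀ x y z : Fin 4 → ℕ, (∀ i, 0 < x i ∧ 0 < y i ∧ 0 < z i) →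
      (∏ i, x i ^ (i.val + 1)) + (∏ i, y i ^ (i.val + 1)) = ∏ i, z i ^ (i.val + 1) →
      ((∏ i, z i ^ (i.val + 1) : ℕ) : ℝ) < C * ((∏ i, x i * y i * z i : ℕ) : ℝ) ^ (A + ε) := by
  intro h
  have hmax : max A 0 < 4 / 3 := max_lt hA (by norm_num)
  have hA0 : A ≤ max A 0 := le_max_left _ _
  have h0 : 0 ≤ max A 0 := le_max_right _ _
  set s : ℝ := (max A 0 + 4 / 3) / 2 with hs
  have hsA : A < s := by rw [hs]; linarith
  have hs43 : s < 4 / 3 := by rw [hs]; linarith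
  have hs0 : 0 < s := by rw [hs]; linarith
  obtain ⟨C, hC, h⟩ := h (s - A) (by linarith)
  obtain ⟨M, hM1, hM⟩ := key_growth (K := 4 * C) (by positivity) (by linarith : 3 * s / 4 < 1)
  obtain ⟨k, hk⟩ := exists_nat_gt M
  have key := h ![1, 1, 1, 2 ^ k] ![1, 1, 1, 2 ^ k] ![2, 1, 1, 2 ^ k]
    (by intro i; fin_cases i <;> simp) (by simp [Fin.prod_univ_four]; ring)
  simp [Fin.prod_univ_four] at key
  -- key : 2 * (2 ^ k) ^ 4 < C * (2 * (2 ^ k * 2 ^ k * 2 ^ k)) ^ s     (in ℝ)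
  set t : ℝ := 2 ^ k with ht
  have ht1 : (1 : ℝ) ≤ t := one_le_pow₀ (by norm_num)
  have ht0 : (0 : ℝ) ≤ t := by linarith
  have hkt : (k : ℝ) < t := by rw [ht]; exact_mod_cast Nat.lt_two_pow_self
  have htt : t ≤ t ^ 4 := by
    have := Nat.le_self_pow (by norm_num : 4 ≠ 0) (2 ^ k)
    have : ((2 ^ k : ℕ) : ℝ) ≤ ((2 ^ k : ℕ) : ℝ) ^ 4 := by exact_mod_cast this
    push_cast at this; rw [ht]; exact this
  have hb := hM (t ^ 4) (by linarith [hk.le])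
  -- hb : 4 * C * (t ^ 4) ^ (3 * s / 4) ≤ t ^ 4
  have h2s : (2 : ℝ) ^ s ≤ 4 := by
    calc (2 : ℝ) ^ s ≤ (2 : ℝ) ^ (2 : ℝ) :=
          Real.rpow_le_rpow_of_exponent_le (by norm_num) (by linarith)
      _ = 4 := by norm_num
  have h3 : (t * t * t) ^ s = (t ^ 4) ^ (3 * s / 4) := by
    rw [show t * t * t = t ^ 3 by ring, pow_three_rpow ht0, show 3 * s / 4 = (3 * s) / 4 by ring,
      pow_four_rpow ht0]
  have h4 : C * (2 * (t * t * t)) ^ s ≤ 4 * C * (t ^ 4) ^ (3 * s / 4) := by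
    rw [Real.mul_rpow (by norm_num) (by positivity), h3]
    have hnn : (0 : ℝ) ≤ (t ^ 4) ^ (3 * s / 4) := Real.rpow_nonneg (by positivity) _
    calc C * ((2 : ℝ) ^ s * (t ^ 4) ^ (3 * s / 4)) = (2 : ℝ) ^ s * (C * (t ^ 4) ^ (3 * s / 4)) := by ring
      _ ≤ 4 * (C * (t ^ 4) ^ (3 * s / 4)) :=
          mul_le_mul_of_nonneg_right h2s (mul_nonneg hC.le hnn)
      _ = 4 * C * (t ^ 4) ^ (3 * s / 4) := by ring
  have ht4 : (0 : ℝ) < t ^ 4 := by positivity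
  linarith

/-! ## (b) Tightness: the dial cannot go below `1`, and `ε` cannot be dropped at `A = 1`
(Pell families, embedded from level 2: `X_2 ↪ X_4`). -/

/-- `1 < 2` in `ℕ`, the parameter `a1` of Mathlib's `Pell.xn`/`Pell.yn` with `a = 2` (`d = 3`). -/
theorem one_lt_two' : (1 : ℕ) < 2 := by norm_num

/-- Mathlib's Pell sequences for `a = 2` solve `x² − 3y² = 1`. -/
theorem pell3 (n : ℕ) : Pell.xn one_lt_two' n ^ 2 = 3 * Pell.yn one_lt_two' n ^ 2 + 1 := by
  have h := Pell.pell_eqz one_lt_two' n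
  rw [Pell.dz_val] at h
  have h' : (Pell.xn one_lt_two' n : ℤ) ^ 2 = 3 * (Pell.yn one_lt_two' n : ℤ) ^ 2 + 1 := by
    simp only [Pell.xz, Pell.yz, Pell.az] at h; push_cast at h; linarith
  exact_mod_cast h'

/-- `yₙ ≤ xₙ` for the `d = 3` Pell sequences. -/
theorem pell3_y_le_x (n : ℕ) : Pell.yn one_lt_two' n ≤ Pell.xn one_lt_two' n := by
  have h := pell3 n
  have : Pell.yn one_lt_two' n ^ 2 ≤ Pell.xn one_lt_two' n ^ 2 := by rw [h]; nlinarith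
  exact (Nat.pow_le_pow_iff_left (by norm_num)).mp this

/-- **The dial cannot go below 1.** For every `A < 1`, `TowerIneq(4, A)` fails: the Pell family
`1 + 3v² = u²` (`x = (1,1,1,1)`, `y = (3,v,1,1)`, `z = (1,u,1,1)`) has `c = u²` and
`Π = 3uv ≤ 3u² = 3c`, so `c < C Π^{s}` with `s < 1` fails for large `u`. -/
theorem towerIneq4_false_below_one (A : ℝ) (hA : A < 1) :
    ¬ ∀ ε : ℝ, 0 < ε → ∃ C : ℝ, 0 < C ∧ ∀ x y z : Fin 4 → ℕ, (∀ i, 0 < x i ∧ 0 < y i ∧ 0 < z i) →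
      (∏ i, x i ^ (i.val + 1)) + (∏ i, y i ^ (i.val + 1)) = ∏ i, z i ^ (i.val + 1) →
      Nat.Coprime (∏ i, x i ^ (i.val + 1)) (∏ i, y i ^ (i.val + 1)) →
      ((∏ i, z i ^ (i.val + 1) : ℕ) : ℝ) < C * ((∏ i, x i * y i * z i : ℕ) : ℝ) ^ (A + ε) := by
  intro h
  have hmax : max A 0 < 1 := max_lt hA one_pos
  have hA0 : A ≤ max A 0 := le_max_left _ _
  have h0 : 0 ≤ max A 0 := le_max_right _ _
  set s : ℝ := (max A 0 + 1) / 2 with hs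
  have hsA : A < s := by rw [hs]; linarith
  have hs1 : s < 1 := by rw [hs]; linarith
  have hs0 : 0 < s := by rw [hs]; linarith
  obtain ⟨C, hC, h⟩ := h (s - A) (by linarith)
  obtain ⟨M, hM1, hM⟩ := key_growth (K := 3 * C) (by positivity) hs1
  obtain ⟨n, hn⟩ := exists_nat_gt M
  have hn0 : 0 < n := by exact_mod_cast (lt_of_lt_of_le zero_lt_one hM1).trans hn
  obtain ⟨u, hu⟩ : ∃ u, Pell.xn one_lt_two' n = u := ⟨_, rfl⟩
  obtain ⟨v, hv⟩ : ∃ v, Pell.yn one_lt_two' n = v := ⟨_, rfl⟩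
  have hnu : n < u := hu ▸ Pell.n_lt_xn one_lt_two' n
  have hu0 : 0 < u := lt_trans hn0 hnu
  have hv0 : 0 < v := hv ▸ lt_of_lt_of_le hn0 (Pell.yn_ge_n one_lt_two' n)
  have hvu : v ≤ u := hu ▸ hv ▸ pell3_y_le_x n
  have heq : 1 + 3 * v ^ 2 = u ^ 2 := by rw [← hu, ← hv, pell3 n]; ring
  have key := h ![1, 1, 1, 1] ![3, v, 1, 1] ![1, u, 1, 1]
    (by intro i; fin_cases i <;> simp [hu0, hv0]) (by simp [Fin.prod_univ_four]; omega)
    (by simp [Fin.prod_univ_four])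
  simp [Fin.prod_univ_four] at key
  -- key : (u:ℝ) ^ 2 < C * (3 * (v * u)) ^ s
  have hu1 : (1 : ℝ) ≤ u := by exact_mod_cast hu0
  have huR : (0 : ℝ) ≤ u := by positivity
  have hvuR : (v : ℝ) ≤ u := by exact_mod_cast hvu
  have hvR : (0 : ℝ) ≤ v := by positivity
  have hT : M ≤ (u : ℝ) ^ 2 := by
    have h1 : (n : ℝ) < u := by exact_mod_cast hnu
    have h2 : (u : ℝ) ≤ (u : ℝ) ^ 2 := by nlinarith
    linarith
  have hb := hM ((u : ℝ) ^ 2) hT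
  -- hb : 3 * C * (u ^ 2) ^ s ≤ u ^ 2
  have h3s : (3 : ℝ) ^ s ≤ 3 := by
    calc (3 : ℝ) ^ s ≤ (3 : ℝ) ^ (1 : ℝ) := Real.rpow_le_rpow_of_exponent_le (by norm_num) hs1.le
      _ = 3 := Real.rpow_one _
  have h4 : C * (3 * ((v : ℝ) * u)) ^ s ≤ 3 * C * ((u : ℝ) ^ 2) ^ s := by
    have hmono : (3 * ((v : ℝ) * u)) ^ s ≤ (3 * ((u : ℝ) ^ 2)) ^ s :=
      Real.rpow_le_rpow (by positivity) (by nlinarith) hs0.le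
    have hsplit : (3 * ((u : ℝ) ^ 2)) ^ s = (3 : ℝ) ^ s * ((u : ℝ) ^ 2) ^ s :=
      Real.mul_rpow (by norm_num) (by positivity)
    rw [hsplit] at hmono
    have hnn : (0 : ℝ) ≤ ((u : ℝ) ^ 2) ^ s := Real.rpow_nonneg (by positivity) _
    calc C * (3 * ((v : ℝ) * u)) ^ s ≤ C * ((3 : ℝ) ^ s * ((u : ℝ) ^ 2) ^ s) :=
          mul_le_mul_of_nonneg_left hmono hC.le
      _ = (3 : ℝ) ^ s * (C * ((u : ℝ) ^ 2) ^ s) := by ring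
      _ ≤ 3 * (C * ((u : ℝ) ^ 2) ^ s) := mul_le_mul_of_nonneg_right h3s (mul_nonneg hC.le hnn)
      _ = 3 * C * ((u : ℝ) ^ 2) ^ s := by ring
  linarith

/-- **`ε` cannot be dropped at `A = 1`** (tower analogue of `EpsilonCannotBeDropped`): with
`w = y_N`, `m = N·w`, Matiyasevich's `w² ∣ y_m` (`Pell.ysq_dvd_yy`) writes `v = y_m = w²t`, and the
point `x = (1,1,1,1)`, `y = (3,t,1,w)`, `z = (1,u,1,1)` (`u = x_m`) has `b = 3t²w⁴ = 3v²`, `c = u²`,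
`Π = 3tuw = 3uv/w ≤ 3c/N`; so `c < CΠ` fails once `N > 3C`. -/
theorem not_towerIneq4OneNoEps :
    ¬ ∃ C : ℝ, 0 < C ∧ ∀ x y z : Fin 4 → ℕ, (∀ i, 0 < x i ∧ 0 < y i ∧ 0 < z i) →
      (∏ i, x i ^ (i.val + 1)) + (∏ i, y i ^ (i.val + 1)) = ∏ i, z i ^ (i.val + 1) →
      Nat.Coprime (∏ i, x i ^ (i.val + 1)) (∏ i, y i ^ (i.val + 1)) →
      ((∏ i, z i ^ (i.val + 1) : ℕ) : ℝ) < C * ((∏ i, x i * y i * z i : ℕ) : ℝ) := by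
  rintro ⟨C, hC, h⟩
  obtain ⟨n, hn⟩ := exists_nat_gt (3 * C)
  obtain ⟨w, hw⟩ : ∃ w, Pell.yn one_lt_two' (n + 1) = w := ⟨_, rfl⟩
  have hwN : n + 1 ≤ w := hw ▸ Pell.yn_ge_n one_lt_two' (n + 1)
  have hw0 : 0 < w := lt_of_lt_of_le (Nat.succ_pos n) hwN
  obtain ⟨u, hu⟩ : ∃ u, Pell.xn one_lt_two' ((n + 1) * w) = u := ⟨_, rfl⟩
  obtain ⟨v, hv⟩ : ∃ v, Pell.yn one_lt_two' ((n + 1) * w) = v := ⟨_, rfl⟩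
  have hm0 : 0 < (n + 1) * w := Nat.mul_pos (Nat.succ_pos n) hw0
  have hv0 : 0 < v := hv ▸ lt_of_lt_of_le hm0 (Pell.yn_ge_n one_lt_two' _)
  have hu0 : 0 < u := hu ▸ Pell.x_pos one_lt_two' _
  have hvu : v ≤ u := hu ▸ hv ▸ pell3_y_le_x _
  have heq : 1 + 3 * v ^ 2 = u ^ 2 := by rw [← hu, ← hv, pell3]; ring
  have hdvd : w * w ∣ v := by
    have := Pell.ysq_dvd_yy one_lt_two' (n + 1)
    rwa [hw, hv] at this
  obtain ⟨t, ht⟩ := hdvd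
  have ht0 : 0 < t := by
    rcases Nat.eq_zero_or_pos t with h0 | h0
    · rw [h0, mul_zero] at ht; omega
    · exact h0
  have key := h ![1, 1, 1, 1] ![3, t, 1, w] ![1, u, 1, 1]
    (by intro i; fin_cases i <;> simp [hu0, hw0, ht0])
    (by simp [Fin.prod_univ_four]; rw [← heq, ht]; ring)
    (by simp [Fin.prod_univ_four])
  simp [Fin.prod_univ_four] at key
  -- key : (u:ℝ) ^ 2 < C * (3 * (t * u) * w)
  have h1 : 3 * C * ((t : ℝ) * w) ≤ (u : ℝ) := by
    have htw : (0 : ℝ) ≤ (t : ℝ) * w := by positivity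
    have hN' : 3 * C ≤ ((n + 1 : ℕ) : ℝ) := by push_cast; linarith
    have hwN' : ((n + 1 : ℕ) : ℝ) ≤ w := by exact_mod_cast hwN
    have hvu' : (v : ℝ) ≤ u := by exact_mod_cast hvu
    have hv' : (v : ℝ) = w * w * t := by exact_mod_cast ht
    calc 3 * C * ((t : ℝ) * w) ≤ ((n + 1 : ℕ) : ℝ) * ((t : ℝ) * w) := mul_le_mul_of_nonneg_right hN' htw
      _ ≤ w * ((t : ℝ) * w) := mul_le_mul_of_nonneg_right hwN' htw
      _ = v := by rw [hv']; ring
      _ ≤ u := hvu'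
  have h2 : C * (3 * ((t : ℝ) * u) * w) ≤ (u : ℝ) ^ 2 := by
    have hu' : (0 : ℝ) ≤ u := by positivity
    calc C * (3 * ((t : ℝ) * u) * w) = (3 * C * ((t : ℝ) * w)) * u := by ring
      _ ≤ u * u := mul_le_mul_of_nonneg_right h1 hu'
      _ = (u : ℝ) ^ 2 := by ring
  linarith


/-- **The crux with `2` replaced by `1` is false**: `¬ ∃ A < 1, TowerIneq(4, A)` — the sibling of
`IneffectiveSubspace.TowerFourSubLiouville` one notch down the dial (from `towerIneq4_false_below_one`). -/
theorem towerFour_false_with_threshold_one :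
    ¬ ∃ A : ℝ, A < 1 ∧ ∀ ε : ℝ, 0 < ε → ∃ C : ℝ, 0 < C ∧ ∀ x y z : Fin 4 → ℕ, (∀ i, 0 < x i ∧ 0 < y i ∧ 0 < z i) →
      (∏ i, x i ^ (i.val + 1)) + (∏ i, y i ^ (i.val + 1)) = ∏ i, z i ^ (i.val + 1) →
      Nat.Coprime (∏ i, x i ^ (i.val + 1)) (∏ i, y i ^ (i.val + 1)) →
      ((∏ i, z i ^ (i.val + 1) : ℕ) : ℝ) < C * ((∏ i, x i * y i * z i : ℕ) : ℝ) ^ (A + ε) := by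
  rintro ⟨A, hA, h⟩
  exact towerIneq4_false_below_one A hA h

/-! ## (c) Constants: with `C = 1` the exponent must exceed `1.3` -/

/-- The record small point: `1 + 4374 = 4375` (`4374 = 2·3⁷`, `4375 = 5⁴·7`), lifted minimally as
`x = (1,1,1,1)`, `y = (2,1,3,3)` (`2·1²·3³·3⁴ = 4374`), `z = (7,1,1,5)` (`7·5⁴ = 4375`): `Π = 630`,
tower quality `log 4375 / log 630 = 1.30066`, and `630^{13/10} < 4375` (`630¹³ < 4375¹⁰`). -/
theorem quality_point_4375 :
    ∃ x y z : Fin 4 → ℕ, (∀ i, 0 < x i ∧ 0 < y i ∧ 0 < z i) ∧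
      (∏ i, x i ^ (i.val + 1)) + (∏ i, y i ^ (i.val + 1)) = ∏ i, z i ^ (i.val + 1) ∧
      Nat.Coprime (∏ i, x i ^ (i.val + 1)) (∏ i, y i ^ (i.val + 1)) ∧
      ((∏ i, z i ^ (i.val + 1) : ℕ) : ℝ) = 4375 ∧ ((∏ i, x i * y i * z i : ℕ) : ℝ) = 630 ∧
      ((∏ i, x i * y i * z i : ℕ) : ℝ) ^ ((13:ℝ) / 10) < ((∏ i, z i ^ (i.val + 1) : ℕ) : ℝ) := by
  refine ⟨![1, 1, 1, 1], ![2, 1, 3, 3], ![7, 1, 1, 5], ?_, by decide, by decide, ?_, ?_, ?_⟩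
  · intro i; fin_cases i <;> simp
  · simp [Fin.prod_univ_four]
  · simp [Fin.prod_univ_four]
  · simp [Fin.prod_univ_four]
    norm_num
    -- goal: (630:ℝ) ^ (13/10) < 4375
    refine lt_of_pow_lt_pow_left₀ 10 (by norm_num) ?_
    rw [← Real.rpow_natCast, ← Real.rpow_mul (by norm_num)]
    norm_num

/-- Hence `TowerIneq(4, ·)` with constant `C = 1` needs exponent `> 13/10`: the shape
`c < 1 · Π^{13/10}` fails at the point above. -/
theorem not_towerIneq4_constant_one_exponent_13_10 :
    ¬ ∀ x y z : Fin 4 → ℕ, (∀ i, 0 < x i ∧ 0 < y i ∧ 0 < z i) →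
      (∏ i, x i ^ (i.val + 1)) + (∏ i, y i ^ (i.val + 1)) = ∏ i, z i ^ (i.val + 1) →
      Nat.Coprime (∏ i, x i ^ (i.val + 1)) (∏ i, y i ^ (i.val + 1)) →
      ((∏ i, z i ^ (i.val + 1) : ℕ) : ℝ) < 1 * ((∏ i, x i * y i * z i : ℕ) : ℝ) ^ ((13:ℝ) / 10) := by
  intro h
  obtain ⟨x, y, z, hpos, heq, hcop, -, -, hlt⟩ := quality_point_4375
  have := h x y z hpos heq hcop
  linarith

end Summit.ABC.ABC.Theorems.TowerFourSubLiouville.Negative
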